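import Summits.NavierStokesRegularity.NavierStokesRegularity.Theorems.FilamentSkeletonRssSkeletonJ1RSingularBranchTools

/-!
# Route `FilamentSkeletonRss` · crux `SkeletonJ1R` (stmt-NavierStokesRegularity-23610) · registered line `streamline_kantorovich_R`
# — brick K-§3a for stub K `KantorovichClosingL`: THE NONLINEAR REGULAR BRANCH AT A SINGULARITY OF THE FIRST KIND
# (Levinson's integral equation from the singular end, nonlinear perturbation)

Hand `ns-filament-21221-p1` (g18), `--supports stmt-NavierStokesRegularity-23610 --as helper`; pure Mathlib, route-independent.

WHY.  Stub K (`SkeletonJ1RFrame.KantorovichClosingL`; K-notes §3 of the lead: «graph transform instead of a stable-manifold theorem»)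
needs the UNSTABLE STREAMLINE of the switched field `f` through its waist zero `p` as a `C¹` curve tangent to the unstable eigenvector
`ξ` (`Df(p) ξ = λ ξ`, `λ > 0`).  By the parameterization method (`Literature.Analysis.ODE.ParameterizationMethod`) it is a solution `P` of
the singular invariance equation `λ s P′(s) = f(P(s))`, `P(0) = p`, `P′(0) = ξ`; the substitution `P(s) = p + s q(s)` turns this into an
ODE with a singularity of the first kind,
  `s q′(s) = K₀ q(s) + s · H(s, q(s))`,  `K₀ = λ⁻¹ Df(p) − 1` (`K₀ ξ = 0`),  `H(s, q) = (f(p + s q) − Df(p)[s q]) / (λ s²)`,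
with `H` BOUNDED and LIPSCHITZ in `q` when `Df` is Lipschitz at `p`.  THIS FILE solves that equation abstractly (`exists_singularBranch`)
— the nonlinear twin of the tree's LINEAR `Literature.Analysis.ODE.exists_regularBranch_real` (`x w′ = (K₀ + x G(x)) w`): given `Pr`
with `K₀ ∘ Pr = K₀`, `Pr ξ = 0` and a BOUNDED forward semigroup `‖exp(t K₀) Pr v‖ ≤ C ‖Pr v‖` (`t ≥ 0`), and `H` continuous on
`(0, δ₀] × B̄(ξ, R)`, bounded by `M`, `L`-Lipschitz in `q`, Levinson's integral equation FROM THE SINGULAR END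
  `q(x) = ξ + ∫₀ˣ (1 − Pr) H(s, q(s)) ds + x^{K₀} ∫₀ˣ s^{−K₀} Pr H(s, q(s)) ds`,  `x^{K₀} := exp(log x · K₀)`,
is a `½`-contraction on `B̄(ξ, R)`-valued bounded continuous functions (argument frozen at `δ`; the Euler kernel
`exp((log x − log s) K₀) Pr`, `0 < s ≤ x`, is bounded by `C‖Pr‖`), and its fixed point solves the equation on `(0, δ)` with `q(0) = ξ`,
`‖q(x) − ξ‖ ≤ min R (C₁ x)`, `‖x q′(x)‖ ≤ C₁ x`.  The companion `…SkeletonJ1RUnstableCurve.lean` feeds `H = g(sq)/(λs²)` on both sides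
of `s = 0` and returns the `C¹` unstable curve.

HONEST FRAMING.  A generic ODE lemma, sub-brick of an OPEN stub (K) of the ∃-side of a HYPOTHETICAL filament-type rotating-self-similar
blow-up skeleton (MODEL rung, negative side); stub K, the crux 23610 and its heart stay OPEN; nothing here is a claim about Navier–Stokes
regularity or blow-up.  References: Coddington–Levinson, *Theory of ODE* (1955), Ch. 3 §8 Thm 8.1 / eq. (8.13), Ch. 13 Thm 4.1;
Cabré–Fontich–de la Llave, *The parameterization method for invariant manifolds I*, Indiana Univ. Math. J. 52 (2003).
-/

set_option linter.dupNamespace false -- `NavierStokesRegularity.NavierStokesRegularity` path/namespace repetition is the tree convention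

noncomputable section

namespace Summit.NavierStokesRegularity.NavierStokesRegularity.Theorems.SkeletonJ1RUnstableCurve

open Set Function Filter MeasureTheory intervalIntegral Metric NormedSpace
open scoped Topology BoundedContinuousFunction NNReal

variable {E : Type*} [NormedAddCommGroup E] [NormedSpace ℝ E] [CompleteSpace E]

/-- **THE NONLINEAR REGULAR BRANCH AT A SINGULARITY OF THE FIRST KIND** (Levinson's integral equation from the singular end, nonlinear
perturbation).  Let `E` be a real Banach space, `K₀, Pr` bounded operators with `K₀ ∘ Pr = K₀` (i.e. `K₀` vanishes on the range of `1 − Pr`),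
`Pr ξ = 0`, and `‖exp(t K₀) (Pr v)‖ ≤ C ‖Pr v‖` for all `t ≥ 0` (bounded forward semigroup on the range of `Pr`).  Let `H : ℝ → E → E` be
continuous on `(0, δ₀] × B̄(ξ, R)`, bounded by `M` and `L`-Lipschitz in the second variable there.  Then for some `δ ∈ (0, δ₀]` and `C₁ ≥ 0`
there is `q`, continuous on `[0, δ]` with `q(0) = ξ`, `‖q(x) − ξ‖ ≤ min R (C₁ x)`, differentiable on `(0, δ)` with continuous derivative
`q′`, solving `x q′(x) = K₀ q(x) + x H(x, q(x))` there, with `‖x q′(x)‖ ≤ C₁ x`.  (Fixed point of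
`q ↦ ξ + ∫₀ˣ (1 − Pr) H(s, q) ds + exp(log x K₀) ∫₀ˣ exp(−log s K₀) Pr H(s, q) ds` on `B̄(ξ, R)`-valued bounded continuous functions.)
[cite: CoddingtonLevinson1955, Ch. 3 §8 Theorem 8.1 and eq. (8.13)] -/
theorem exists_singularBranch {K₀ Pr : E →L[ℝ] E} {H : ℝ → E → E} {ξ : E} {δ₀ C M L R : ℝ}
    (hδ₀ : 0 < δ₀) (hM : 0 ≤ M) (hL : 0 ≤ L) (hR : 0 < R)
    (hK₀Pr : ∀ v, K₀ (Pr v) = K₀ v) (hPrξ : Pr ξ = 0)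
    (hbound : ∀ t : ℝ, 0 ≤ t → ∀ v : E, ‖exp (t • K₀) (Pr v)‖ ≤ C * ‖Pr v‖)
    (hHc : ContinuousOn (uncurry H) (Ioc 0 δ₀ ×ˢ closedBall ξ R))
    (hHM : ∀ s ∈ Ioc 0 δ₀, ∀ q ∈ closedBall ξ R, ‖H s q‖ ≤ M)
    (hHL : ∀ s ∈ Ioc 0 δ₀, ∀ q ∈ closedBall ξ R, ∀ q' ∈ closedBall ξ R, ‖H s q - H s q'‖ ≤ L * ‖q - q'‖) :
    ∃ δ C₁ : ℝ, ∃ q q' : ℝ → E, 0 < δ ∧ δ ≤ δ₀ ∧ 0 ≤ C₁ ∧ q 0 = ξ ∧ ContinuousOn q (Icc 0 δ) ∧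
      (∀ x ∈ Icc 0 δ, ‖q x - ξ‖ ≤ R) ∧ (∀ x ∈ Icc 0 δ, ‖q x - ξ‖ ≤ C₁ * x) ∧
      (∀ x ∈ Ioo 0 δ, HasDerivAt q (q' x) x) ∧ ContinuousOn q' (Ioo 0 δ) ∧
      (∀ x ∈ Ioo 0 δ, x • q' x = K₀ (q x) + x • H x (q x)) ∧
      (∀ x ∈ Ioo 0 δ, ‖x • q' x‖ ≤ C₁ * x) := by
  /- constants -/
  set C' : ℝ := max C 0 with hC'
  have hC'0 : 0 ≤ C' := le_max_right _ _
  have hbound' : ∀ t : ℝ, 0 ≤ t → ∀ v : E, ‖exp (t • K₀) (Pr v)‖ ≤ C' * ‖Pr v‖ := fun t ht v =>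
    (hbound t ht v).trans (mul_le_mul_of_nonneg_right (le_max_left _ _) (norm_nonneg _))
  set A₁ : ℝ := 1 + ‖Pr‖ with hA₁
  set A₂ : ℝ := C' * ‖Pr‖ with hA₂
  have hA₁0 : 0 ≤ A₁ := by positivity
  have hA₂0 : 0 ≤ A₂ := by positivity
  set Mt : ℝ := (A₁ + A₂) * M with hMt
  set Lt : ℝ := (A₁ + A₂) * L with hLt
  have hMt0 : 0 ≤ Mt := by positivity
  have hLt0 : 0 ≤ Lt := by positivity
  set δ₁ : ℝ := min δ₀ 1 with hδ₁
  have hδ₁0 : 0 < δ₁ := lt_min hδ₀ one_pos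
  set δ : ℝ := min (δ₁ / 2) (min (R / (Mt + 1)) (1 / (2 * (Lt + 1)))) with hδdef
  have hδpos : 0 < δ := lt_min (half_pos hδ₁0) (lt_min (by positivity) (by positivity))
  have hδδ₁ : δ < δ₁ := lt_of_le_of_lt (min_le_left _ _) (half_lt_self hδ₁0)
  have hδδ₀ : δ < δ₀ := lt_of_lt_of_le hδδ₁ (min_le_left _ _)
  have hδ1 : δ < 1 := lt_of_lt_of_le hδδ₁ (min_le_right _ _)
  have hδle : δ ≤ δ₀ := hδδ₀.le
  have hδMt : Mt * δ ≤ R := by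
    have h1 : δ ≤ R / (Mt + 1) := (min_le_right _ _).trans (min_le_left _ _)
    calc Mt * δ ≤ Mt * (R / (Mt + 1)) := mul_le_mul_of_nonneg_left h1 hMt0
      _ ≤ (Mt + 1) * (R / (Mt + 1)) := mul_le_mul_of_nonneg_right (by linarith) (by positivity)
      _ = R := by field_simp
  have hδLt : δ * Lt ≤ 1 / 2 := by
    have h1 : δ ≤ 1 / (2 * (Lt + 1)) := (min_le_right _ _).trans (min_le_right _ _)
    have h2 : 1 / (2 * (Lt + 1)) * Lt ≤ 1 / 2 := by
      rw [div_mul_eq_mul_div, one_mul, div_le_iff₀ (by positivity)]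
      nlinarith
    exact (mul_le_mul_of_nonneg_right h1 hLt0).trans h2
  /- hypotheses restricted to `(0, δ]` (note `δ < δ₀`, `δ < 1`) -/
  have hIocδ : ∀ {s}, s ∈ Ioc 0 δ → s ∈ Ioc 0 δ₀ := fun hs => ⟨hs.1, hs.2.trans hδle⟩
  have hIooδ : ∀ {s}, s ∈ Ioo 0 δ → s ∈ Ioo 0 δ₀ := fun hs => ⟨hs.1, hs.2.trans hδδ₀⟩
  /- the clamp into `[0, δ]` -/
  set c : ℝ → ℝ := fun x => max 0 (min δ x) with hc
  have hc_mem : ∀ x, c x ∈ Icc 0 δ := fun x => ⟨le_max_left _ _, max_le hδpos.le (min_le_left _ _)⟩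
  have hc_id : ∀ x ∈ Icc 0 δ, c x = x := fun x hx => by
    simp only [hc, min_eq_right hx.2, max_eq_right hx.1]
  have hc_cont : Continuous c := continuous_const.max (continuous_const.min continuous_id)
  /- kernel bounds (tools): `A₂ = C'‖Pr‖` bounds `exp(−log s K₀)Π` (`0 < s ≤ 1`) and `exp(log y K₀)exp(−log s K₀)Π` (`0 < s ≤ y`) -/
  have hker₁ : ∀ {s : ℝ}, 0 < s → s ≤ 1 → ∀ w : E, ‖exp ((-Real.log s) • K₀) (Pr w)‖ ≤ A₂ * ‖w‖ :=
    fun hs hs1 w => norm_exp_neg_log_smul_apply_le hC'0 hbound' hs hs1 w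
  have hker₂ : ∀ {s y : ℝ}, 0 < s → s ≤ y → ∀ w : E,
      ‖exp (Real.log y • K₀) (exp ((-Real.log s) • K₀) (Pr w))‖ ≤ A₂ * ‖w‖ :=
    fun hs hsy w => norm_exp_log_smul_apply_apply_le hC'0 hbound' hs hsy w
  have hsubPr : ∀ w : E, ‖w - Pr w‖ ≤ A₁ * ‖w‖ := fun w => by
    calc ‖w - Pr w‖ ≤ ‖w‖ + ‖Pr w‖ := norm_sub_le _ _
      _ ≤ ‖w‖ + ‖Pr‖ * ‖w‖ := by gcongr; exact Pr.le_opNorm w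
      _ = A₁ * ‖w‖ := by rw [hA₁]; ring
  /- the integrands, for a continuous `B̄(ξ,R)`-valued `φ` -/
  set F₁ : (ℝ → E) → ℝ → E := fun φ s => H s (φ s) - Pr (H s (φ s)) with hF₁
  set F₂ : (ℝ → E) → ℝ → E := fun φ s => exp ((-Real.log s) • K₀) (Pr (H s (φ s))) with hF₂
  -- continuity of `s ↦ H s (φ s)` on `(0, δ₀)`, hence of the integrands
  have hHφ : ∀ {φ : ℝ → E}, Continuous φ → (∀ s, ‖φ s - ξ‖ ≤ R) →
      ContinuousOn (fun s => H s (φ s)) (Ioo 0 δ₀) := by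
    intro φ hφ hφR
    have hmaps : MapsTo (fun s => (s, φ s)) (Ioo 0 δ₀) (Ioc 0 δ₀ ×ˢ closedBall ξ R) := fun s hs =>
      ⟨⟨hs.1, hs.2.le⟩, mem_closedBall.2 (by rw [dist_eq_norm]; exact hφR s)⟩
    exact hHc.comp (continuousOn_id.prodMk hφ.continuousOn) hmaps
  have hF₁c : ∀ {φ : ℝ → E}, Continuous φ → (∀ s, ‖φ s - ξ‖ ≤ R) → ContinuousOn (F₁ φ) (Ioo 0 δ₀) := by
    intro φ hφ hφR
    exact (hHφ hφ hφR).sub (Pr.continuous.comp_continuousOn (hHφ hφ hφR))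
  have hF₂c : ∀ {φ : ℝ → E}, Continuous φ → (∀ s, ‖φ s - ξ‖ ≤ R) → ContinuousOn (F₂ φ) (Ioo 0 δ₀) := by
    intro φ hφ hφR
    exact ((continuousOn_exp_neg_log_smul K₀).mono fun s hs => hs.1).clm_apply
      (Pr.continuous.comp_continuousOn (hHφ hφ hφR))
  -- pointwise bounds on `(0, δ]`
  have hF₁b : ∀ {φ : ℝ → E}, (∀ s, ‖φ s - ξ‖ ≤ R) → ∀ s ∈ Ioc 0 δ, ‖F₁ φ s‖ ≤ A₁ * M := by
    intro φ hφR s hs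
    have hq : φ s ∈ closedBall ξ R := mem_closedBall.2 (by rw [dist_eq_norm]; exact hφR s)
    exact (hsubPr _).trans (mul_le_mul_of_nonneg_left (hHM s (hIocδ hs) _ hq) hA₁0)
  have hF₂b : ∀ {φ : ℝ → E}, (∀ s, ‖φ s - ξ‖ ≤ R) → ∀ s ∈ Ioc 0 δ, ‖F₂ φ s‖ ≤ A₂ * M := by
    intro φ hφR s hs
    have hq : φ s ∈ closedBall ξ R := mem_closedBall.2 (by rw [dist_eq_norm]; exact hφR s)
    exact (hker₁ hs.1 (hs.2.trans hδ1.le) _).trans (mul_le_mul_of_nonneg_left (hHM s (hIocδ hs) _ hq) hA₂0)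
  -- Lipschitz bounds on `(0, δ]`
  have hF₁L : ∀ {φ ψ : ℝ → E}, (∀ s, ‖φ s - ξ‖ ≤ R) → (∀ s, ‖ψ s - ξ‖ ≤ R) → ∀ s ∈ Ioc 0 δ,
      ‖F₁ φ s - F₁ ψ s‖ ≤ A₁ * L * ‖φ s - ψ s‖ := by
    intro φ ψ hφR hψR s hs
    have hq : φ s ∈ closedBall ξ R := mem_closedBall.2 (by rw [dist_eq_norm]; exact hφR s)
    have hq' : ψ s ∈ closedBall ξ R := mem_closedBall.2 (by rw [dist_eq_norm]; exact hψR s)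
    have e : F₁ φ s - F₁ ψ s = (H s (φ s) - H s (ψ s)) - Pr (H s (φ s) - H s (ψ s)) := by
      simp only [hF₁, map_sub]; abel
    rw [e]
    calc ‖(H s (φ s) - H s (ψ s)) - Pr (H s (φ s) - H s (ψ s))‖ ≤ A₁ * ‖H s (φ s) - H s (ψ s)‖ := hsubPr _
      _ ≤ A₁ * (L * ‖φ s - ψ s‖) := mul_le_mul_of_nonneg_left (hHL s (hIocδ hs) _ hq _ hq') hA₁0
      _ = A₁ * L * ‖φ s - ψ s‖ := by ring
  have hF₂L : ∀ {φ ψ : ℝ → E}, (∀ s, ‖φ s - ξ‖ ≤ R) → (∀ s, ‖ψ s - ξ‖ ≤ R) → ∀ {s y : ℝ}, s ∈ Ioc 0 δ → s ≤ y →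
      ‖exp (Real.log y • K₀) (F₂ φ s - F₂ ψ s)‖ ≤ A₂ * L * ‖φ s - ψ s‖ := by
    intro φ ψ hφR hψR s y hs hsy
    have hq : φ s ∈ closedBall ξ R := mem_closedBall.2 (by rw [dist_eq_norm]; exact hφR s)
    have hq' : ψ s ∈ closedBall ξ R := mem_closedBall.2 (by rw [dist_eq_norm]; exact hψR s)
    have e : F₂ φ s - F₂ ψ s = exp ((-Real.log s) • K₀) (Pr (H s (φ s) - H s (ψ s))) := by
      simp only [hF₂, map_sub]
    rw [e]
    calc ‖exp (Real.log y • K₀) (exp ((-Real.log s) • K₀) (Pr (H s (φ s) - H s (ψ s))))‖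
        ≤ A₂ * ‖H s (φ s) - H s (ψ s)‖ := hker₂ hs.1 hsy _
      _ ≤ A₂ * (L * ‖φ s - ψ s‖) := mul_le_mul_of_nonneg_left (hHL s (hIocδ hs) _ hq _ hq') hA₂0
      _ = A₂ * L * ‖φ s - ψ s‖ := by ring
  -- integrability on `[0, y]`, `y ∈ [0, δ]`
  have hF₁i : ∀ {φ : ℝ → E}, Continuous φ → (∀ s, ‖φ s - ξ‖ ≤ R) → ∀ y ∈ Icc 0 δ,
      IntervalIntegrable (F₁ φ) volume 0 y := by
    intro φ hφ hφR y hy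
    exact intervalIntegrable_of_continuousOn_Ioc hy.1
      ((hF₁c hφ hφR).mono fun s hs => ⟨hs.1, lt_of_le_of_lt hs.2 (lt_of_le_of_lt hy.2 hδδ₀)⟩)
      (fun s hs => hF₁b hφR s ⟨hs.1, hs.2.trans hy.2⟩)
  have hF₂i : ∀ {φ : ℝ → E}, Continuous φ → (∀ s, ‖φ s - ξ‖ ≤ R) → ∀ y ∈ Icc 0 δ,
      IntervalIntegrable (F₂ φ) volume 0 y := by
    intro φ hφ hφR y hy
    exact intervalIntegrable_of_continuousOn_Ioc hy.1
      ((hF₂c hφ hφR).mono fun s hs => ⟨hs.1, lt_of_le_of_lt hs.2 (lt_of_le_of_lt hy.2 hδδ₀)⟩)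
      (fun s hs => hF₂b hφR s ⟨hs.1, hs.2.trans hy.2⟩)
  /- the two primitives and the singular term -/
  set I₁ : (ℝ → E) → ℝ → E := fun φ y => ∫ s in (0 : ℝ)..y, F₁ φ s with hI₁
  set I₂ : (ℝ → E) → ℝ → E := fun φ y => ∫ s in (0 : ℝ)..y, F₂ φ s with hI₂
  set J : (ℝ → E) → ℝ → E := fun φ y => exp (Real.log y • K₀) (I₂ φ y) with hJ
  have hI₁0 : ∀ φ : ℝ → E, I₁ φ 0 = 0 := fun φ => by simp only [hI₁, intervalIntegral.integral_same]
  have hI₂0 : ∀ φ : ℝ → E, I₂ φ 0 = 0 := fun φ => by simp only [hI₂, intervalIntegral.integral_same]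
  have hJ0 : ∀ φ : ℝ → E, J φ 0 = 0 := fun φ => by simp only [hJ, hI₂0, map_zero]
  -- bounds
  have hI₁b : ∀ {φ : ℝ → E}, (∀ s, ‖φ s - ξ‖ ≤ R) → ∀ y ∈ Icc 0 δ, ‖I₁ φ y‖ ≤ A₁ * M * y := by
    intro φ hφR y hy
    exact norm_integral_le_of_le_on_Ioc hy.1 fun s hs => hF₁b hφR s ⟨hs.1, hs.2.trans hy.2⟩
  have hJb : ∀ {φ : ℝ → E}, Continuous φ → (∀ s, ‖φ s - ξ‖ ≤ R) → ∀ y ∈ Icc 0 δ, ‖J φ y‖ ≤ A₂ * M * y := by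
    intro φ hφ hφR y hy
    rcases hy.1.eq_or_lt with rfl | hy'
    · simp [hJ0]
    · have hcomm : J φ y = ∫ s in (0 : ℝ)..y, exp (Real.log y • K₀) (F₂ φ s) := by
        simp only [hJ, hI₂]
        rw [ContinuousLinearMap.intervalIntegral_comp_comm _ (hF₂i hφ hφR y hy)]
      rw [hcomm]
      refine norm_integral_le_of_le_on_Ioc hy.1 fun s hs => ?_
      have hq : φ s ∈ closedBall ξ R := mem_closedBall.2 (by rw [dist_eq_norm]; exact hφR s)
      simp only [hF₂]
      exact (hker₂ hs.1 hs.2 _).trans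
        (mul_le_mul_of_nonneg_left (hHM s (hIocδ ⟨hs.1, hs.2.trans hy.2⟩) _ hq) hA₂0)
  -- derivatives of the primitives on `(0, δ)`
  -- derivatives of the primitives on `(0, δ]` (note `δ < δ₀`)
  have hI₁d : ∀ {φ : ℝ → E}, Continuous φ → (∀ s, ‖φ s - ξ‖ ≤ R) → ∀ y ∈ Ioc 0 δ,
      HasDerivAt (I₁ φ) (F₁ φ y) y := by
    intro φ hφ hφR y hy
    exact intervalIntegral.integral_hasDerivAt_right (hF₁i hφ hφR y ⟨hy.1.le, hy.2⟩)
      ((hF₁c hφ hφR).stronglyMeasurableAtFilter isOpen_Ioo y ⟨hy.1, lt_of_le_of_lt hy.2 hδδ₀⟩)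
      ((hF₁c hφ hφR).continuousAt (Ioo_mem_nhds hy.1 (lt_of_le_of_lt hy.2 hδδ₀)))
  have hI₂d : ∀ {φ : ℝ → E}, Continuous φ → (∀ s, ‖φ s - ξ‖ ≤ R) → ∀ y ∈ Ioc 0 δ,
      HasDerivAt (I₂ φ) (F₂ φ y) y := by
    intro φ hφ hφR y hy
    exact intervalIntegral.integral_hasDerivAt_right (hF₂i hφ hφR y ⟨hy.1.le, hy.2⟩)
      ((hF₂c hφ hφR).stronglyMeasurableAtFilter isOpen_Ioo y ⟨hy.1, lt_of_le_of_lt hy.2 hδδ₀⟩)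
      ((hF₂c hφ hφR).continuousAt (Ioo_mem_nhds hy.1 (lt_of_le_of_lt hy.2 hδδ₀)))
  have hJd : ∀ {φ : ℝ → E}, Continuous φ → (∀ s, ‖φ s - ξ‖ ≤ R) → ∀ y ∈ Ioo 0 δ,
      HasDerivAt (J φ) ((y⁻¹ • (K₀ * exp (Real.log y • K₀))) (I₂ φ y) + exp (Real.log y • K₀) (F₂ φ y)) y := by
    intro φ hφ hφR y hy
    exact (hasDerivAt_exp_log_smul K₀ hy.1).clm_apply (hI₂d hφ hφR y ⟨hy.1, hy.2.le⟩)
  -- continuity of the primitives and of the singular term on `[0, δ]`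
  have hI₁c : ∀ {φ : ℝ → E}, Continuous φ → (∀ s, ‖φ s - ξ‖ ≤ R) → ContinuousOn (I₁ φ) (Icc 0 δ) := by
    intro φ hφ hφR y hy
    rcases hy.1.eq_or_lt with rfl | hy'
    · exact continuousWithinAt_zero_of_norm_le_mul (hI₁0 φ) (hI₁b hφR)
    · exact (hI₁d hφ hφR y ⟨hy', hy.2⟩).continuousAt.continuousWithinAt
  have hJc' : ∀ {φ : ℝ → E}, Continuous φ → (∀ s, ‖φ s - ξ‖ ≤ R) → ∀ y ∈ Ioc 0 δ, ContinuousAt (J φ) y := by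
    intro φ hφ hφR y hy
    exact ((continuousOn_exp_log_smul K₀).continuousAt (Ioi_mem_nhds hy.1)).clm_apply (hI₂d hφ hφR y hy).continuousAt
  have hJc : ∀ {φ : ℝ → E}, Continuous φ → (∀ s, ‖φ s - ξ‖ ≤ R) → ContinuousOn (J φ) (Icc 0 δ) := by
    intro φ hφ hφR y hy
    rcases hy.1.eq_or_lt with rfl | hy'
    · exact continuousWithinAt_zero_of_norm_le_mul (hJ0 φ) (hJb hφ hφR)
    · exact (hJc' hφ hφR y ⟨hy', hy.2⟩).continuousWithinAt
  /- the Volterra operator, frozen at `δ`, on `B̄(ξ, R)`-valued bounded continuous functions -/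
  set Top : (ℝ → E) → ℝ → E := fun φ x => ξ + I₁ φ (c x) + J φ (c x) with hTop
  have hTop_cont : ∀ {φ : ℝ → E}, Continuous φ → (∀ s, ‖φ s - ξ‖ ≤ R) → Continuous (Top φ) := by
    intro φ hφ hφR
    have h1 : Continuous fun x => I₁ φ (c x) := (hI₁c hφ hφR).comp_continuous hc_cont hc_mem
    have h2 : Continuous fun x => J φ (c x) := (hJc hφ hφR).comp_continuous hc_cont hc_mem
    simp only [hTop]
    exact (continuous_const.add h1).add h2
  have hTop_sub_ξ : ∀ {φ : ℝ → E}, Continuous φ → (∀ s, ‖φ s - ξ‖ ≤ R) → ∀ x,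
      ‖Top φ x - ξ‖ ≤ Mt * c x := by
    intro φ hφ hφR x
    have hy := hc_mem x
    have e : Top φ x - ξ = I₁ φ (c x) + J φ (c x) := by simp only [hTop]; abel
    rw [e]
    calc ‖I₁ φ (c x) + J φ (c x)‖ ≤ ‖I₁ φ (c x)‖ + ‖J φ (c x)‖ := norm_add_le _ _
      _ ≤ A₁ * M * c x + A₂ * M * c x := add_le_add (hI₁b hφR _ hy) (hJb hφ hφR _ hy)
      _ = Mt * c x := by rw [hMt]; ring
  have hTop_R : ∀ {φ : ℝ → E}, Continuous φ → (∀ s, ‖φ s - ξ‖ ≤ R) → ∀ x, ‖Top φ x - ξ‖ ≤ R := by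
    intro φ hφ hφR x
    exact (hTop_sub_ξ hφ hφR x).trans ((mul_le_mul_of_nonneg_left (hc_mem x).2 hMt0).trans hδMt)
  have hTop_bd : ∀ {φ : ℝ → E}, Continuous φ → (∀ s, ‖φ s - ξ‖ ≤ R) → ∀ x, ‖Top φ x‖ ≤ ‖ξ‖ + R := by
    intro φ hφ hφR x
    calc ‖Top φ x‖ = ‖ξ + (Top φ x - ξ)‖ := by rw [add_sub_cancel]
      _ ≤ ‖ξ‖ + ‖Top φ x - ξ‖ := norm_add_le _ _
      _ ≤ ‖ξ‖ + R := by gcongr; exact hTop_R hφ hφR x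
  -- the closed set of `B̄(ξ, R)`-valued bounded continuous functions
  set S : Set (ℝ →ᵇ E) := {f | ∀ s, ‖f s - ξ‖ ≤ R} with hSdef
  have hS_closed : IsClosed S := isClosed_setOf_forall_norm_sub_le ξ R
  haveI : CompleteSpace S := hS_closed.completeSpace_coe
  haveI : Nonempty S := ⟨⟨BoundedContinuousFunction.const ℝ ξ, fun s => by
    simp only [BoundedContinuousFunction.const_apply, sub_self, norm_zero]; exact hR.le⟩⟩
  have hmemS : ∀ f : S, ∀ s, ‖(f : ℝ →ᵇ E) s - ξ‖ ≤ R := fun f => f.2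
  set T : S → S := fun f =>
    ⟨BoundedContinuousFunction.ofNormedAddCommGroup (Top f) (hTop_cont (f : ℝ →ᵇ E).continuous (hmemS f))
        (‖ξ‖ + R) (hTop_bd (f : ℝ →ᵇ E).continuous (hmemS f)),
      fun s => hTop_R (f : ℝ →ᵇ E).continuous (hmemS f) s⟩ with hT
  have hT_apply : ∀ (f : S) (x : ℝ), ((T f : S) : ℝ →ᵇ E) x = Top f x := fun f x => rfl
  -- the difference of two images
  have hTop_sub : ∀ (f g : S) (x : ℝ), Top (f : ℝ →ᵇ E) x - Top (g : ℝ →ᵇ E) x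
      = (∫ s in (0 : ℝ)..(c x), (F₁ f s - F₁ g s))
        + ∫ s in (0 : ℝ)..(c x), exp (Real.log (c x) • K₀) (F₂ f s - F₂ g s) := by
    intro f g x
    have hy := hc_mem x
    have hf := (f : ℝ →ᵇ E).continuous; have hg := (g : ℝ →ᵇ E).continuous
    have d1 : I₁ (f : ℝ →ᵇ E) (c x) - I₁ (g : ℝ →ᵇ E) (c x) = ∫ s in (0 : ℝ)..(c x), (F₁ f s - F₁ g s) := by
      simp only [hI₁]
      rw [intervalIntegral.integral_sub (hF₁i hf (hmemS f) _ hy) (hF₁i hg (hmemS g) _ hy)]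
    have d2 : J (f : ℝ →ᵇ E) (c x) - J (g : ℝ →ᵇ E) (c x)
        = ∫ s in (0 : ℝ)..(c x), exp (Real.log (c x) • K₀) (F₂ f s - F₂ g s) := by
      simp only [hJ, hI₂]
      rw [← map_sub, ← intervalIntegral.integral_sub (hF₂i hf (hmemS f) _ hy) (hF₂i hg (hmemS g) _ hy),
        ContinuousLinearMap.intervalIntegral_comp_comm]
      exact (hF₂i hf (hmemS f) _ hy).sub (hF₂i hg (hmemS g) _ hy)
    have e : Top (f : ℝ →ᵇ E) x - Top (g : ℝ →ᵇ E) x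
        = (I₁ (f : ℝ →ᵇ E) (c x) - I₁ (g : ℝ →ᵇ E) (c x)) + (J (f : ℝ →ᵇ E) (c x) - J (g : ℝ →ᵇ E) (c x)) := by
      simp only [hTop]; abel
    rw [e, d1, d2]
  have hT_contr : ContractingWith 2⁻¹ T := by
    refine ⟨inv_lt_one_of_one_lt₀ one_lt_two, LipschitzWith.of_dist_le_mul fun f g => ?_⟩
    rw [Subtype.dist_eq, BoundedContinuousFunction.dist_le (by positivity)]
    intro x
    rw [dist_eq_norm, hT_apply, hT_apply, hTop_sub]
    have hfg : ∀ s, ‖(f : ℝ →ᵇ E) s - (g : ℝ →ᵇ E) s‖ ≤ dist f g := fun s => by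
      rw [Subtype.dist_eq, ← dist_eq_norm]; exact (f : ℝ →ᵇ E).dist_coe_le_dist s
    have hy := hc_mem x
    have e1 : ‖∫ s in (0 : ℝ)..(c x), (F₁ (f : ℝ →ᵇ E) s - F₁ (g : ℝ →ᵇ E) s)‖ ≤ A₁ * L * dist f g * c x := by
      refine norm_integral_le_of_le_on_Ioc hy.1 fun s hs => ?_
      exact (hF₁L (hmemS f) (hmemS g) s ⟨hs.1, hs.2.trans hy.2⟩).trans
        (mul_le_mul_of_nonneg_left (hfg s) (by positivity))
    have e2 : ‖∫ s in (0 : ℝ)..(c x), exp (Real.log (c x) • K₀) (F₂ (f : ℝ →ᵇ E) s - F₂ (g : ℝ →ᵇ E) s)‖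
        ≤ A₂ * L * dist f g * c x := by
      refine norm_integral_le_of_le_on_Ioc hy.1 fun s hs => ?_
      exact (hF₂L (hmemS f) (hmemS g) ⟨hs.1, hs.2.trans hy.2⟩ hs.2).trans
        (mul_le_mul_of_nonneg_left (hfg s) (by positivity))
    calc ‖(∫ s in (0 : ℝ)..(c x), (F₁ (f : ℝ →ᵇ E) s - F₁ (g : ℝ →ᵇ E) s))
          + ∫ s in (0 : ℝ)..(c x), exp (Real.log (c x) • K₀) (F₂ (f : ℝ →ᵇ E) s - F₂ (g : ℝ →ᵇ E) s)‖
        ≤ A₁ * L * dist f g * c x + A₂ * L * dist f g * c x := (norm_add_le _ _).trans (add_le_add e1 e2)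
      _ = Lt * dist f g * c x := by rw [hLt]; ring
      _ ≤ Lt * dist f g * δ := by gcongr; exact hy.2
      _ = (δ * Lt) * dist f g := by ring
      _ ≤ (1 / 2) * dist f g := mul_le_mul_of_nonneg_right hδLt dist_nonneg
      _ = ((2⁻¹ : ℝ≥0) : ℝ) * dist f g := by norm_num
  /- the fixed point -/
  set u₀ : S := ContractingWith.fixedPoint T hT_contr with hu₀
  have hfix₀ : T u₀ = u₀ := hT_contr.fixedPoint_isFixedPt
  set q : ℝ → E := fun x => (u₀ : ℝ →ᵇ E) x with hq
  have hqc : Continuous q := (u₀ : ℝ →ᵇ E).continuous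
  have hqR : ∀ s, ‖q s - ξ‖ ≤ R := hmemS u₀
  have hfix : ∀ x, q x = Top q x := fun x => by
    have h := congrArg (fun h : S => ((h : S) : ℝ →ᵇ E) x) hfix₀
    simp only [hT_apply] at h
    exact h.symm
  -- the integral equation on `[0, δ]`
  have hEQ : ∀ x ∈ Icc 0 δ, q x = ξ + I₁ q x + J q x := by
    intro x hx
    have h := hfix x
    simp only [hTop, hc_id x hx] at h
    exact h
  have hq0 : q 0 = ξ := by rw [hEQ 0 ⟨le_rfl, hδpos.le⟩, hI₁0, hJ0, add_zero, add_zero]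
  have hqlin : ∀ x ∈ Icc 0 δ, ‖q x - ξ‖ ≤ Mt * x := by
    intro x hx
    have h := hTop_sub_ξ hqc hqR x
    rwa [← hfix x, hc_id x hx] at h
  -- `K₀ q = K₀ J` on `[0, δ]` (`K₀` kills `ξ` and the `(1 − Pr)`-integral)
  have hK₀ξ : K₀ ξ = 0 := by rw [← hK₀Pr, hPrξ, map_zero]
  have hK₀I₁ : ∀ x ∈ Icc 0 δ, K₀ (I₁ q x) = 0 := by
    intro x hx
    simp only [hI₁]
    rw [← ContinuousLinearMap.intervalIntegral_comp_comm _ (hF₁i hqc hqR x hx)]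
    have e : (fun s => K₀ (F₁ q s)) = fun _ => (0 : E) := by
      funext s; simp only [hF₁, map_sub, hK₀Pr, sub_self]
    rw [e, intervalIntegral.integral_zero]
  have hK₀q : ∀ x ∈ Icc 0 δ, K₀ (q x) = K₀ (J q x) := by
    intro x hx
    rw [hEQ x hx, map_add, map_add, hK₀ξ, hK₀I₁ x hx, zero_add, zero_add]
  /- the derivative on `(0, δ)` -/
  set q' : ℝ → E := fun y => H y (q y) + y⁻¹ • K₀ (J q y) with hq'
  have hderiv : ∀ x ∈ Ioo 0 δ, HasDerivAt q (q' x) x := by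
    intro x hx
    have hx0 : x ≠ 0 := hx.1.ne'
    have hF : HasDerivAt (fun y => ξ + I₁ q y + J q y) (q' x) x := by
      refine (((hI₁d hqc hqR x ⟨hx.1, hx.2.le⟩).const_add ξ).add (hJd hqc hqR x hx)).congr_deriv ?_
      have e : (x⁻¹ • (K₀ * exp (Real.log x • K₀))) (I₂ q x) = x⁻¹ • K₀ (exp (Real.log x • K₀) (I₂ q x)) := rfl
      simp only [hq', hF₁, hF₂, hJ]
      rw [exp_smul_apply_exp_neg_smul, e]
      abel
    refine hF.congr_of_eventuallyEq ?_
    filter_upwards [Icc_mem_nhds hx.1 hx.2] with y hy using hEQ y hy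
  have hODE : ∀ x ∈ Ioo 0 δ, x • q' x = K₀ (q x) + x • H x (q x) := by
    intro x hx
    have hx0 : x ≠ 0 := hx.1.ne'
    simp only [hq']
    rw [smul_add, smul_smul, mul_inv_cancel₀ hx0, one_smul, hK₀q x ⟨hx.1.le, hx.2.le⟩, add_comm]
  have hq'c : ContinuousOn q' (Ioo 0 δ) := by
    have h1 : ContinuousOn (fun y => H y (q y)) (Ioo 0 δ) := (hHφ hqc hqR).mono fun y hy => hIooδ hy
    have h2 : ContinuousOn (fun y : ℝ => y⁻¹) (Ioo 0 δ) :=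
      continuousOn_inv₀.mono fun y hy => (ne_of_gt hy.1 : y ≠ 0)
    have h3 : ContinuousOn (fun y => K₀ (J q y)) (Ioo 0 δ) := fun y hy =>
      (K₀.continuous.continuousAt.comp (hJc' hqc hqR y ⟨hy.1, hy.2.le⟩)).continuousWithinAt
    simp only [hq']
    exact h1.add (h2.smul h3)
  have hxq' : ∀ x ∈ Ioo 0 δ, ‖x • q' x‖ ≤ (M + ‖K₀‖ * (A₂ * M)) * x := by
    intro x hx
    have hxI : x ∈ Icc 0 δ := ⟨hx.1.le, hx.2.le⟩
    have hqx : q x ∈ closedBall ξ R := mem_closedBall.2 (by rw [dist_eq_norm]; exact hqR x)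
    rw [hODE x hx, hK₀q x hxI]
    calc ‖K₀ (J q x) + x • H x (q x)‖ ≤ ‖K₀ (J q x)‖ + ‖x • H x (q x)‖ := norm_add_le _ _
      _ ≤ ‖K₀‖ * ‖J q x‖ + |x| * ‖H x (q x)‖ := by
          gcongr
          · exact K₀.le_opNorm _
          · rw [norm_smul, Real.norm_eq_abs]
      _ ≤ ‖K₀‖ * (A₂ * M * x) + x * M := by
          rw [abs_of_pos hx.1]
          exact add_le_add (mul_le_mul_of_nonneg_left (hJb hqc hqR x hxI) (norm_nonneg _))
            (mul_le_mul_of_nonneg_left (hHM x (hIocδ ⟨hx.1, hx.2.le⟩) _ hqx) hx.1.le)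
      _ = (M + ‖K₀‖ * (A₂ * M)) * x := by ring
  /- assemble, with `C₁ = max Mt (M + ‖K₀‖ A₂ M)` -/
  set C₁ : ℝ := max Mt (M + ‖K₀‖ * (A₂ * M)) with hC₁
  have hC₁0 : 0 ≤ C₁ := hMt0.trans (le_max_left _ _)
  refine ⟨δ, C₁, q, q', hδpos, hδle, hC₁0, hq0, hqc.continuousOn, fun x _ => hqR x,
    fun x hx => (hqlin x hx).trans (mul_le_mul_of_nonneg_right (le_max_left _ _) hx.1),
    hderiv, hq'c, hODE,
    fun x hx => (hxq' x hx).trans (mul_le_mul_of_nonneg_right (le_max_right _ _) hx.1.le)⟩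

end Summit.NavierStokesRegularity.NavierStokesRegularity.Theorems.SkeletonJ1RUnstableCurve

end
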